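import Literature.Geometry.Riemannian.BirkhoffCurveShortening
import HarnessLib

/-!
# Lusternik–Fet / Birkhoff deformation in a non-trapping convex domain: every continuous family
of loops in the interior of `D` contracts, through loops, to a family of point loops

The homotopy-theoretic half of the proof of `PaternainSaloUhlmann2023_contractible_sublevel`
(PSU 2023, Prop. 3.7.22, via the closed-geodesic route of Remark 3.7.23): Birkhoff's
curve-shortening (`BirkhoffCurveShortening.lean`) applied to a whole continuous family of loops.

* `continuous_geodesicSegment_family`, `geodesicSegment_mem_lt` — the short-geodesic ("straight")
  homotopy between two pointwise close maps, and why it stays in `{ρ < 0}`.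
* `birkhoffStep_admissible_lt` — the Birkhoff step keeps vertices in the interior `{ρ < 0}`.
* `edist_polygonLoop_le`, `edist_polygonLoop_birkhoffStep_lt`,
  `edist_base_polygonLoop_lt_of_energy_lt` — uniform closeness of a polygon to its vertices, to its
  Birkhoff image (`< 3ε₁`), and (small energy) to the constant loop at its base vertex.
* `exists_nat_forall_edist_lt` — sampling: a continuous family over a compact parameter space is
  uniformly fine in the loop parameter.
* `exists_deformation_to_const` — **the deformation theorem**: a `1`-fine continuous family of
  loops on `[0, N]` in `{ρ < 0}`, constant `x₀` over `A`, deforms continuously, through families of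
  (free) loops in `{ρ < 0}` constant over `A`, into a family of constant loops: join `F` to the
  polygon loops of the sampled polygons, push those down by `m` Birkhoff steps (`m` from the
  uniform energy decay `exists_forall_polygonEnergy_iterate_lt` — non-trapping), and contract the
  resulting short polygons to their base vertices; consecutive stages are `3ε₁`-close and are
  joined by straight homotopies, glued by `glueFin`.

No definitions, no named facts (D-0026).

## References

* J. Milnor, *Morse theory*, Princeton 1963, §16. [Milnor1963]
* G. P. Paternain, M. Salo, G. Uhlmann, *Geometric inverse problems*, CUP 2023, Prop. 3.7.22,
  Remark 3.7.23. [PaternainSaloUhlmann2023]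
-/

noncomputable section

open Bundle Set Filter Function Metric Manifold
open scoped Manifold ContDiff Topology ENNReal NNReal

namespace Literature.Geometry.Riemannian

open Literature.Geometry.Lorentzian
open Literature.Geometry.Lorentzian.PseudoRiemannianMetric

variable {E : Type*} [NormedAddCommGroup E] [NormedSpace ℝ E] {H : Type*} [TopologicalSpace H]
  {I : ModelWithCorners ℝ E H} {M : Type*} [TopologicalSpace M] [ChartedSpace H M]
  [IsManifold I ∞ M] {n : ℕ∞ω} [FiniteDimensional ℝ E] [CompleteSpace E] [T2Space M]
  [I.Boundaryless] [CompactSpace M]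
  {g : PseudoRiemannianMetric I n E (TangentSpace I : M → Type _)} [g.HasLeviCivita]
  {ρ : M → ℝ} {ℓ₀ : ℝ}

/-! ### Straight (short-geodesic) homotopies between nearby maps -/

section Straight

variable {Y : Type*} [TopologicalSpace Y]

/-- **Two pointwise `ε(M,g)`-close continuous maps are joined by the short-geodesic homotopy**
`(σ, y) ↦ S(G₀ y, G₁ y)(σ)`, which is continuous (joint continuity of the segment in its
endpoints and parameter). [cite: Milnor1963, §16 (p. 88–89)] -/
theorem continuous_geodesicSegment_family (hn : (∞ : ℕ∞ω) ≤ n) (hg : g.IsRiemannian) {G₀ G₁ : Y → M} (h₀ : Continuous G₀) (h₁ : Continuous G₁)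
    (hclose : ∀ y, g.edist hg (G₀ y) (G₁ y) < ENNReal.ofReal (uniformNormalRadius g hn hg)) :
    Continuous fun p : ℝ × Y ↦ geodesicSegment g hn hg (G₀ p.2) (G₁ p.2) p.1 := by
  have h := continuousOn_geodesicSegment hn hg
  have h2 : Continuous fun p : ℝ × Y ↦ ((G₀ p.2, G₁ p.2), p.1) :=
    ((h₀.comp continuous_snd).prodMk (h₁.comp continuous_snd)).prodMk continuous_fst
  exact h.comp_continuous h2 fun p ↦ ⟨hclose p.2, mem_univ _⟩

/-- The short-geodesic homotopy stays in the interior `{ρ < 0}` when its ends do (short geodesics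
with endpoints in `{ρ < 0}` stay in `{ρ < 0}`, hypothesis `hstay'` =
`IsStrictlyConvexSublevel.exists_pos_forall_isGeodesic`, applied below speed `ℓ₀`).
[cite: PaternainSaloUhlmann2023, Lemma 3.1.12] -/
theorem geodesicSegment_mem_lt (hn : (∞ : ℕ∞ω) ≤ n) (hg : g.IsRiemannian)
    (hstay' : ∀ γ : ℝ → M, IsGeodesic g.leviCivita γ →
      g.val (γ 0) (velocity I γ 0) (velocity I γ 0) < ℓ₀ ^ 2 →
      ρ (γ 0) < 0 → ρ (γ 1) < 0 → ∀ t ∈ Icc (0 : ℝ) 1, ρ (γ t) < 0)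
    {δ : ℝ} (hδℓ : δ ≤ ℓ₀) (hδε : δ ≤ uniformNormalRadius g hn hg)
    {x y : M} (hx : ρ x < 0) (hy : ρ y < 0) (hxy : g.edist hg x y < ENNReal.ofReal δ)
    {t : ℝ} (ht : t ∈ Icc (0 : ℝ) 1) : ρ (geodesicSegment g hn hg x y t) < 0 := by
  have hε := uniformNormalRadius_pos hn hg
  have hxy' : g.edist hg x y < ENNReal.ofReal (uniformNormalRadius g hn hg) :=
    lt_of_lt_of_le hxy (ENNReal.ofReal_le_ofReal hδε)
  refine hstay' _ (isGeodesic_geodesicSegment hn hg x y) ?_ (by rwa [geodesicSegment_zero])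
    (by rwa [geodesicSegment_one hn hg hxy']) t ht
  rw [geodesicSegment_zero, velocity_geodesicSegment_zero]
  have hδ0 : 0 < δ := by
    by_contra h0
    push Not at h0
    rw [ENNReal.ofReal_of_nonpos h0] at hxy
    exact absurd hxy (not_lt.2 bot_le)
  have h1 : Real.sqrt (g.val x (geodesicJoin g hn hg x y) (geodesicJoin g hn hg x y)) < δ := by
    rw [sqrt_geodesicJoin_eq_toReal hn hg hxy']
    have h := ENNReal.toReal_strict_mono ENNReal.ofReal_ne_top hxy
    rwa [ENNReal.toReal_ofReal hδ0.le] at h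
  have h2 : Real.sqrt (g.val x (geodesicJoin g hn hg x y) (geodesicJoin g hn hg x y)) < ℓ₀ :=
    lt_of_lt_of_le h1 hδℓ
  rw [Real.sqrt_lt' (lt_of_lt_of_le hδ0 hδℓ)] at h2
  exact h2

end Straight

/-! ### The Birkhoff step keeps the vertices in the interior -/

section Interior

variable {N : ℕ} [NeZero N] {ε₁ : ℝ}

/-- Strict version of `birkhoffStep_admissible`: vertices in `{ρ < 0}` stay in `{ρ < 0}`.
[cite: PaternainSaloUhlmann2023, Lemma 3.1.12] -/
theorem birkhoffStep_admissible_lt (hn : (∞ : ℕ∞ω) ≤ n) (hg : g.IsRiemannian)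
    (hstay : ∀ γ : ℝ → M, IsGeodesic g.leviCivita γ →
      g.val (γ 0) (velocity I γ 0) (velocity I γ 0) < ℓ₀ ^ 2 →
      ρ (γ 0) ≤ 0 → ρ (γ 1) ≤ 0 → ∀ t ∈ Icc (0 : ℝ) 1, ρ (γ t) ≤ 0)
    (hstay' : ∀ γ : ℝ → M, IsGeodesic g.leviCivita γ →
      g.val (γ 0) (velocity I γ 0) (velocity I γ 0) < ℓ₀ ^ 2 →
      ρ (γ 0) < 0 → ρ (γ 1) < 0 → ∀ t ∈ Icc (0 : ℝ) 1, ρ (γ t) < 0)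
    (hε₁ℓ : ε₁ < ℓ₀) (hε₁ε : ε₁ < uniformNormalRadius g hn hg) (hε₁ : 0 ≤ ε₁)
    {x : Fin N → M} (hx : ∀ i, ρ (x i) < 0 ∧ g.edist hg (x i) (x (i + 1)) ≤ ENNReal.ofReal ε₁) :
    ∀ i, ρ (birkhoffStep g hn hg x i) < 0 ∧
      g.edist hg (birkhoffStep g hn hg x i) (birkhoffStep g hn hg x (i + 1)) ≤ ENNReal.ofReal ε₁ := by
  have hε := uniformNormalRadius_pos hn hg
  have hweak := birkhoffStep_admissible hn hg hstay hε₁ℓ hε₁ε hε₁ (fun i ↦ ⟨(hx i).1.le, (hx i).2⟩)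
  intro i
  refine ⟨?_, (hweak i).2⟩
  have hlt : g.edist hg (x i) (x (i + 1)) < ENNReal.ofReal (uniformNormalRadius g hn hg) :=
    lt_of_le_of_lt (hx i).2 ((ENNReal.ofReal_lt_ofReal_iff hε).2 hε₁ε)
  -- apply `hstay'` to the segment of speed `≤ ε₁ < ℓ₀`
  refine hstay' _ (isGeodesic_geodesicSegment hn hg (x i) (x (i + 1))) ?_
    (by rw [geodesicSegment_zero]; exact (hx i).1)
    (by rw [geodesicSegment_one hn hg hlt]; exact (hx (i + 1)).1) _ ⟨by norm_num, by norm_num⟩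
  rw [geodesicSegment_zero, velocity_geodesicSegment_zero]
  have h1 : Real.sqrt (g.val (x i) (geodesicJoin g hn hg (x i) (x (i + 1)))
      (geodesicJoin g hn hg (x i) (x (i + 1)))) ≤ ε₁ := by
    rw [sqrt_geodesicJoin_eq_toReal hn hg hlt]
    have h := ENNReal.toReal_mono ENNReal.ofReal_ne_top (hx i).2
    rwa [ENNReal.toReal_ofReal hε₁] at h
  have hℓ₀ : 0 < ℓ₀ := lt_of_le_of_lt hε₁ hε₁ℓ
  have h2 := lt_of_le_of_lt h1 hε₁ℓ
  rw [Real.sqrt_lt' hℓ₀] at h2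
  exact h2

/-- Iterates of the Birkhoff step keep the vertices in the interior. [cite: PaternainSaloUhlmann2023, Lemma 3.1.12] -/
theorem birkhoffStep_iterate_admissible_lt (hn : (∞ : ℕ∞ω) ≤ n) (hg : g.IsRiemannian)
    (hstay : ∀ γ : ℝ → M, IsGeodesic g.leviCivita γ →
      g.val (γ 0) (velocity I γ 0) (velocity I γ 0) < ℓ₀ ^ 2 →
      ρ (γ 0) ≤ 0 → ρ (γ 1) ≤ 0 → ∀ t ∈ Icc (0 : ℝ) 1, ρ (γ t) ≤ 0)
    (hstay' : ∀ γ : ℝ → M, IsGeodesic g.leviCivita γ →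
      g.val (γ 0) (velocity I γ 0) (velocity I γ 0) < ℓ₀ ^ 2 →
      ρ (γ 0) < 0 → ρ (γ 1) < 0 → ∀ t ∈ Icc (0 : ℝ) 1, ρ (γ t) < 0)
    (hε₁ℓ : ε₁ < ℓ₀) (hε₁ε : ε₁ < uniformNormalRadius g hn hg) (hε₁ : 0 ≤ ε₁) (m : ℕ)
    {x : Fin N → M} (hx : ∀ i, ρ (x i) < 0 ∧ g.edist hg (x i) (x (i + 1)) ≤ ENNReal.ofReal ε₁) :
    ∀ i, ρ ((birkhoffStep g hn hg)^[m] x i) < 0 ∧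
      g.edist hg ((birkhoffStep g hn hg)^[m] x i) ((birkhoffStep g hn hg)^[m] x (i + 1)) ≤
        ENNReal.ofReal ε₁ := by
  induction m with
  | zero => exact hx
  | succ m ih =>
    rw [Function.iterate_succ_apply']
    exact birkhoffStep_admissible_lt hn hg hstay hstay' hε₁ℓ hε₁ε hε₁ ih

/-- A constant polygon is fixed by the Birkhoff step. [folklore] -/
theorem birkhoffStep_const (hn : (∞ : ℕ∞ω) ≤ n) (hg : g.IsRiemannian) (x₀ : M) : birkhoffStep g hn hg (fun _ : Fin N ↦ x₀) = fun _ ↦ x₀ := by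
  funext i
  exact geodesicSegment_self hn hg x₀ _

/-- A constant polygon is fixed by the iterated Birkhoff step. [folklore] -/
theorem birkhoffStep_iterate_const (hn : (∞ : ℕ∞ω) ≤ n) (hg : g.IsRiemannian) (x₀ : M) (m : ℕ) :
    (birkhoffStep g hn hg)^[m] (fun _ : Fin N ↦ x₀) = fun _ ↦ x₀ := by
  induction m with
  | zero => rfl
  | succ m ih => rw [Function.iterate_succ_apply', ih, birkhoffStep_const]

/-- The polygon of a constant family of vertices is the constant loop. [folklore] -/
theorem polygonLoop_const (hn : (∞ : ℕ∞ω) ≤ n) (hg : g.IsRiemannian) (x₀ : M) (t : ℝ) : polygonLoop g hn hg (fun _ : Fin N ↦ x₀) t = x₀ := by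
  rw [polygonLoop, glueFin]
  exact geodesicSegment_self hn hg x₀ _

end Interior

/-! ### How far the polygon strays from its vertices -/

section Closeness

variable {N : ℕ} [NeZero N] {ε₁ : ℝ}

/-- **A point of the polygon is within one side length of the two adjacent vertices**: for
`t ∈ [0, N]` and `i = pieceIndex N t`, `polygonLoop x t` lies on the segment from `x i` to
`x (i+1)`, at distance `≤ d(x i, x (i+1))` from both. [cite: Milnor1963, §16 (p. 88–89)] -/
theorem edist_polygonLoop_le (hn : (∞ : ℕ∞ω) ≤ n) (hg : g.IsRiemannian) {x : Fin N → M}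
    (hx : ∀ i, g.edist hg (x i) (x (i + 1)) < ENNReal.ofReal (uniformNormalRadius g hn hg))
    {t : ℝ} (ht : t ∈ Icc (0 : ℝ) N) :
    g.edist hg (x (pieceIndex N t)) (polygonLoop g hn hg x t) ≤
        g.edist hg (x (pieceIndex N t)) (x (pieceIndex N t + 1)) ∧
      g.edist hg (polygonLoop g hn hg x t) (x (pieceIndex N t + 1)) ≤
        g.edist hg (x (pieceIndex N t)) (x (pieceIndex N t + 1)) := by
  set i := pieceIndex N t with hi
  have hs := sub_pieceIndex_mem_Icc (N := N) ht
  have heq : polygonLoop g hn hg x t = geodesicSegment g hn hg (x i) (x (i + 1)) (t - (i : ℕ)) := rfl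
  rw [heq]
  obtain ⟨h1, h2⟩ := edist_geodesicSegment_eq hn hg (hx i) hs
  have hle1 : ENNReal.ofReal (t - (i : ℕ)) ≤ 1 := by
    rw [← ENNReal.ofReal_one]; exact ENNReal.ofReal_le_ofReal hs.2
  have hle2 : ENNReal.ofReal (1 - (t - (i : ℕ))) ≤ 1 := by
    rw [← ENNReal.ofReal_one]; exact ENNReal.ofReal_le_ofReal (by linarith [hs.1])
  constructor
  · rw [h1]
    calc ENNReal.ofReal (t - (i : ℕ)) * g.edist hg (x i) (x (i + 1))
        ≤ 1 * g.edist hg (x i) (x (i + 1)) := by gcongr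
      _ = _ := one_mul _
  · rw [h2]
    calc ENNReal.ofReal (1 - (t - (i : ℕ))) * g.edist hg (x i) (x (i + 1))
        ≤ 1 * g.edist hg (x i) (x (i + 1)) := by gcongr
      _ = _ := one_mul _

/-- **The polygon and its Birkhoff image are uniformly `5ε₁/2`-close**: for a polygon with sides
`≤ ε₁ (< ε(M,g))`, `d(polygonLoop x t, polygonLoop (Ψ x) t) ≤ d(c(t), xᵢ₊₁) + d(xᵢ₊₁, mᵢ) +
d(mᵢ, c'(t)) ≤ ℓᵢ + ½ℓᵢ + ε₁`. [cite: Milnor1963, §16 (p. 88–89)] -/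
theorem edist_polygonLoop_birkhoffStep_lt (hn : (∞ : ℕ∞ω) ≤ n) (hg : g.IsRiemannian) (hε₁ε : ε₁ < uniformNormalRadius g hn hg) (hε₁ : 0 < ε₁)
    {x : Fin N → M} (hx : ∀ i, g.edist hg (x i) (x (i + 1)) ≤ ENNReal.ofReal ε₁)
    (hΨx : ∀ i, g.edist hg (birkhoffStep g hn hg x i) (birkhoffStep g hn hg x (i + 1)) ≤ ENNReal.ofReal ε₁)
    {t : ℝ} (ht : t ∈ Icc (0 : ℝ) N) :
    g.edist hg (polygonLoop g hn hg x t) (polygonLoop g hn hg (birkhoffStep g hn hg x) t) <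
      ENNReal.ofReal (3 * ε₁) := by
  have hε := uniformNormalRadius_pos hn hg
  have hlt : ∀ i, g.edist hg (x i) (x (i + 1)) < ENNReal.ofReal (uniformNormalRadius g hn hg) :=
    fun i ↦ lt_of_le_of_lt (hx i) ((ENNReal.ofReal_lt_ofReal_iff hε).2 hε₁ε)
  have hlt' : ∀ i, g.edist hg (birkhoffStep g hn hg x i) (birkhoffStep g hn hg x (i + 1)) <
      ENNReal.ofReal (uniformNormalRadius g hn hg) :=
    fun i ↦ lt_of_le_of_lt (hΨx i) ((ENNReal.ofReal_lt_ofReal_iff hε).2 hε₁ε)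
  set i := pieceIndex N t with hi
  set m := birkhoffStep g hn hg x with hm
  have hhalf : (1 / 2 : ℝ) ∈ Icc (0 : ℝ) 1 := ⟨by norm_num, by norm_num⟩
  have hA : g.edist hg (polygonLoop g hn hg x t) (x (i + 1)) ≤ ENNReal.ofReal ε₁ :=
    ((edist_polygonLoop_le hn hg hlt ht).2).trans (hx i)
  have hB : g.edist hg (x (i + 1)) (m i) ≤ ENNReal.ofReal (ε₁ / 2) := by
    rw [PseudoRiemannianMetric.edist_comm hg]
    have h := (edist_geodesicSegment_eq hn hg (hlt i) hhalf).2
    have h' : g.edist hg (m i) (x (i + 1)) = ENNReal.ofReal (1 - 1 / 2) * g.edist hg (x i) (x (i + 1)) := h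
    rw [h']
    calc ENNReal.ofReal (1 - 1 / 2) * g.edist hg (x i) (x (i + 1))
        ≤ ENNReal.ofReal (1 - 1 / 2) * ENNReal.ofReal ε₁ := by gcongr; exact hx i
      _ = ENNReal.ofReal (ε₁ / 2) := by rw [← ENNReal.ofReal_mul (by norm_num)]; congr 1; ring
  have hC : g.edist hg (m i) (polygonLoop g hn hg m t) ≤ ENNReal.ofReal ε₁ :=
    ((edist_polygonLoop_le hn hg hlt' ht).1).trans (hΨx i)
  calc g.edist hg (polygonLoop g hn hg x t) (polygonLoop g hn hg m t)
      ≤ g.edist hg (polygonLoop g hn hg x t) (x (i + 1)) + g.edist hg (x (i + 1)) (m i) +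
          g.edist hg (m i) (polygonLoop g hn hg m t) :=
        (edist_triangle hg _ (m i) _).trans (add_le_add (edist_triangle hg _ _ _) le_rfl)
    _ ≤ ENNReal.ofReal ε₁ + ENNReal.ofReal (ε₁ / 2) + ENNReal.ofReal ε₁ := by gcongr
    _ = ENNReal.ofReal (5 * ε₁ / 2) := by
        rw [← ENNReal.ofReal_add hε₁.le (by positivity), ← ENNReal.ofReal_add (by positivity) hε₁.le]
        congr 1; ring
    _ < ENNReal.ofReal (3 * ε₁) := (ENNReal.ofReal_lt_ofReal_iff (by positivity)).2 (by linarith)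

omit [CompleteSpace E] [T2Space M] [I.Boundaryless] [CompactSpace M] [g.HasLeviCivita] in
/-- A vertex is within the length of the preceding sides from the base vertex:
`d(x 0, x k) ≤ ∑_{j < k} ℓⱼ`. [folklore] -/
theorem edist_vertex_le_partial_sum (hg : g.IsRiemannian) (x : Fin N → M) (k : ℕ) (hk : k < N) :
    g.edist hg (x 0) (x ⟨k, hk⟩) ≤
      ∑ j ∈ Finset.univ.filter (fun j : Fin N ↦ (j : ℕ) < k), g.edist hg (x j) (x (j + 1)) := by
  induction k with
  | zero =>
    have h0 : (⟨0, hk⟩ : Fin N) = 0 := rfl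
    rw [h0, PseudoRiemannianMetric.edist_self hg]
    exact bot_le
  | succ k ih =>
    have hk' : k < N := Nat.lt_of_succ_lt hk
    have h1 : (⟨k + 1, hk⟩ : Fin N) = ⟨k, hk'⟩ + 1 := by
      apply Fin.ext
      rw [Fin.val_add]
      simp [Nat.mod_eq_of_lt hk]
    have hnot : (⟨k, hk'⟩ : Fin N) ∉ Finset.univ.filter (fun j : Fin N ↦ (j : ℕ) < k) := by simp
    have hsplit : Finset.univ.filter (fun j : Fin N ↦ (j : ℕ) < k + 1) =
        insert (⟨k, hk'⟩ : Fin N) (Finset.univ.filter (fun j : Fin N ↦ (j : ℕ) < k)) := by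
      ext j
      simp only [Finset.mem_filter, Finset.mem_univ, true_and, Finset.mem_insert]
      constructor
      · intro hj
        rcases Nat.lt_succ_iff_lt_or_eq.1 hj with h | h
        · exact Or.inr h
        · exact Or.inl (Fin.ext h)
      · rintro (h | h)
        · rw [h]; exact Nat.lt_succ_self k
        · exact Nat.lt_succ_of_lt h
    rw [hsplit, Finset.sum_insert hnot]
    calc g.edist hg (x 0) (x ⟨k + 1, hk⟩)
        ≤ g.edist hg (x 0) (x ⟨k, hk'⟩) + g.edist hg (x ⟨k, hk'⟩) (x ⟨k + 1, hk⟩) :=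
          edist_triangle hg _ _ _
      _ ≤ (∑ j ∈ Finset.univ.filter (fun j : Fin N ↦ (j : ℕ) < k), g.edist hg (x j) (x (j + 1))) +
          g.edist hg (x ⟨k, hk'⟩) (x (⟨k, hk'⟩ + 1)) := by rw [← h1]; exact add_le_add (ih hk') le_rfl
      _ = _ := add_comm _ _

/-- **A polygon of small total length stays close to its base vertex**:
`d(x 0, polygonLoop x t) ≤ (∑ⱼ ℓⱼ) + ℓᵢ` where `i = pieceIndex N t` (go along the vertices to
`x i`, then along the `i`-th side). [folklore] -/
theorem edist_base_polygonLoop_le (hn : (∞ : ℕ∞ω) ≤ n) (hg : g.IsRiemannian) {x : Fin N → M}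
    (hx : ∀ i, g.edist hg (x i) (x (i + 1)) < ENNReal.ofReal (uniformNormalRadius g hn hg))
    {t : ℝ} (ht : t ∈ Icc (0 : ℝ) N) :
    g.edist hg (x 0) (polygonLoop g hn hg x t) ≤
      (∑ j, g.edist hg (x j) (x (j + 1))) + g.edist hg (x (pieceIndex N t)) (x (pieceIndex N t + 1)) := by
  set i := pieceIndex N t with hi
  have h1 : g.edist hg (x 0) (x i) ≤ ∑ j, g.edist hg (x j) (x (j + 1)) := by
    have h := edist_vertex_le_partial_sum hg x i i.2
    have hi' : (⟨(i : ℕ), i.2⟩ : Fin N) = i := Fin.ext rfl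
    rw [hi'] at h
    exact h.trans (Finset.sum_le_sum_of_subset (Finset.filter_subset _ _))
  have h2 := (edist_polygonLoop_le hn hg hx ht).1
  calc g.edist hg (x 0) (polygonLoop g hn hg x t)
      ≤ g.edist hg (x 0) (x i) + g.edist hg (x i) (polygonLoop g hn hg x t) := edist_triangle hg _ _ _
    _ ≤ _ := add_le_add h1 h2

/-- **A polygon of small energy is uniformly close to the constant loop at its base vertex**: if
`En(x) < η` (so every side is `< √η`) and `(N + 1) √η ≤ δ`, then
`d(x 0, polygonLoop x t) < δ` for all `t ∈ [0, N]`. [folklore] -/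
theorem edist_base_polygonLoop_lt_of_energy_lt (hn : (∞ : ℕ∞ω) ≤ n) (hg : g.IsRiemannian) {x : Fin N → M}
    (hx : ∀ i, g.edist hg (x i) (x (i + 1)) < ENNReal.ofReal (uniformNormalRadius g hn hg))
    {η δ : ℝ} (hη : 0 < η) (hE : polygonEnergy g hg x < η) (hδ : ((N : ℝ) + 1) * Real.sqrt η ≤ δ)
    {t : ℝ} (ht : t ∈ Icc (0 : ℝ) N) :
    g.edist hg (x 0) (polygonLoop g hn hg x t) < ENNReal.ofReal δ := by
  have hfin : ∀ i, g.edist hg (x i) (x (i + 1)) ≠ ⊤ := fun i ↦ ne_top_of_lt (hx i)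
  set ℓ : Fin N → ℝ := fun j ↦ (g.edist hg (x j) (x (j + 1))).toReal with hℓ
  -- each side is `< √η`
  have hside : ∀ j, ℓ j < Real.sqrt η := by
    intro j
    have h1 : ℓ j ^ 2 ≤ polygonEnergy g hg x :=
      Finset.single_le_sum (f := fun j ↦ ℓ j ^ 2) (fun j _ ↦ sq_nonneg _) (Finset.mem_univ j)
    have h2 : ℓ j ^ 2 < η := lt_of_le_of_lt h1 hE
    have h3 : 0 ≤ ℓ j := ENNReal.toReal_nonneg
    calc ℓ j = Real.sqrt (ℓ j ^ 2) := (Real.sqrt_sq h3).symm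
      _ < Real.sqrt η := Real.sqrt_lt_sqrt (sq_nonneg _) h2
  have hofReal : ∀ j, g.edist hg (x j) (x (j + 1)) = ENNReal.ofReal (ℓ j) := fun j ↦
    (ENNReal.ofReal_toReal (hfin j)).symm
  have hbound := edist_base_polygonLoop_le hn hg hx ht
  set i := pieceIndex N t with hi
  have hsum : (∑ j, g.edist hg (x j) (x (j + 1))) + g.edist hg (x i) (x (i + 1)) <
      ENNReal.ofReal (((N : ℝ) + 1) * Real.sqrt η) := by
    have h1 : (∑ j, g.edist hg (x j) (x (j + 1))) = ENNReal.ofReal (∑ j, ℓ j) := by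
      rw [ENNReal.ofReal_sum_of_nonneg (fun j _ ↦ ENNReal.toReal_nonneg)]
      exact Finset.sum_congr rfl fun j _ ↦ hofReal j
    rw [h1, hofReal i, ← ENNReal.ofReal_add (Finset.sum_nonneg fun j _ ↦ ENNReal.toReal_nonneg)
      ENNReal.toReal_nonneg]
    refine (ENNReal.ofReal_lt_ofReal_iff (by positivity)).2 ?_
    have h2 : ∑ j, ℓ j ≤ ∑ _j : Fin N, Real.sqrt η := Finset.sum_le_sum fun j _ ↦ (hside j).le
    have h3 : ∑ _j : Fin N, Real.sqrt η = N * Real.sqrt η := by simp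
    have h4 := hside i
    nlinarith
  exact lt_of_le_of_lt hbound (lt_of_lt_of_le hsum (ENNReal.ofReal_le_ofReal hδ))

end Closeness

/-! ### Sampling: fineness of a continuous family on a compact parameter space -/

section Sampling

omit [CompleteSpace E] [I.Boundaryless] [g.HasLeviCivita] in
/-- **Uniform continuity in the loop parameter**: for a continuous family `F : X × ℝ → M` over a
compact `X` and `ε' > 0` there is `N ≥ 1` such that `d(F(x, s), F(x, t)) < ε'` whenever
`s, t ∈ [0, 1]`, `|s - t| ≤ 1/N` (compactness of `X × [0,1]²` and continuity of the distance).
[folklore] -/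
theorem exists_nat_forall_edist_lt (hg : g.IsRiemannian) {X : Type*} [TopologicalSpace X] [CompactSpace X]
    {F : X × ℝ → M} (hF : Continuous F) {ε' : ℝ} (hε' : 0 < ε') :
    ∃ N : ℕ, 1 ≤ N ∧ ∀ (x : X) (s t : ℝ), s ∈ Icc (0 : ℝ) 1 → t ∈ Icc (0 : ℝ) 1 →
      |s - t| ≤ 1 / N → g.edist hg (F (x, s)) (F (x, t)) < ENNReal.ofReal ε' := by
  -- the bad set
  set C : Set (X × ℝ × ℝ) := {p | p.2.1 ∈ Icc (0 : ℝ) 1 ∧ p.2.2 ∈ Icc (0 : ℝ) 1 ∧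
    ENNReal.ofReal ε' ≤ g.edist hg (F (p.1, p.2.1)) (F (p.1, p.2.2))} with hC
  have hΦ : Continuous fun p : X × ℝ × ℝ ↦ g.edist hg (F (p.1, p.2.1)) (F (p.1, p.2.2)) :=
    (PseudoRiemannianMetric.continuous_edist hg).comp
      ((hF.comp (continuous_fst.prodMk (continuous_fst.comp continuous_snd))).prodMk
        (hF.comp (continuous_fst.prodMk (continuous_snd.comp continuous_snd))))
  have hCc : IsCompact C := by
    have hK : IsCompact ((univ : Set X) ×ˢ (Icc (0 : ℝ) 1 ×ˢ Icc (0 : ℝ) 1)) :=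
      isCompact_univ.prod (isCompact_Icc.prod isCompact_Icc)
    refine hK.of_isClosed_subset ?_ ?_
    · refine (isClosed_Icc.preimage (continuous_fst.comp continuous_snd)).inter
        ((isClosed_Icc.preimage (continuous_snd.comp continuous_snd)).inter ?_)
      exact isClosed_le continuous_const hΦ
    · rintro ⟨x, s, t⟩ ⟨hs, ht, -⟩
      exact ⟨mem_univ _, hs, ht⟩
  -- on `C` the parameters differ
  have hpos : ∀ p ∈ C, 0 < |p.2.1 - p.2.2| := by
    rintro ⟨x, s, t⟩ ⟨-, -, hle⟩
    dsimp only at hle ⊢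
    rw [abs_pos, sub_ne_zero]
    intro hst
    rw [hst, PseudoRiemannianMetric.edist_self hg] at hle
    exact absurd hle (not_le.2 (ENNReal.ofReal_pos.2 hε'))
  rcases C.eq_empty_or_nonempty with hCe | hCne
  · refine ⟨1, le_rfl, fun x s t hs ht _ ↦ ?_⟩
    by_contra hge
    push Not at hge
    have hmem : (x, s, t) ∈ C := ⟨hs, ht, hge⟩
    rw [hCe] at hmem
    exact hmem
  · have hcont : ContinuousOn (fun p : X × ℝ × ℝ ↦ |p.2.1 - p.2.2|) C :=
      (continuous_abs.comp ((continuous_fst.comp continuous_snd).sub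
        (continuous_snd.comp continuous_snd))).continuousOn
    obtain ⟨p₀, hp₀, hmin⟩ := hCc.exists_isMinOn hCne hcont
    set μ := |p₀.2.1 - p₀.2.2| with hμ
    have hμ0 : 0 < μ := hpos p₀ hp₀
    obtain ⟨N, hN⟩ := exists_nat_one_div_lt hμ0
    refine ⟨N + 1, Nat.le_add_left 1 N, fun x s t hs ht hst ↦ ?_⟩
    by_contra hge
    push Not at hge
    have hmem : (x, s, t) ∈ C := ⟨hs, ht, hge⟩
    have h1 : μ ≤ |s - t| := hmin hmem
    have h2 : |s - t| < μ := lt_of_le_of_lt hst (by push_cast; exact hN)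
    linarith

end Sampling

/-! ### The main deformation: a family of loops in the interior contracts to a family of points -/

section Deformation

variable {N : ℕ} [NeZero N] {ε₁ : ℝ}

/-- **Theorem (Lusternik–Fet / Birkhoff deformation in a non-trapping convex domain).** Let
`D = {ρ ≤ 0}` be a strictly convex, non-trapping sublevel domain of a compact Riemannian manifold,
with the constants `ε(M,g)` (uniform normal radius), `ℓ₀` (short geodesics with ends in `D`,
resp. in `{ρ < 0}`, stay there: `hstay`, `hstay'`) and `0 < ε₁` with `3ε₁ < ε(M,g)`, `3ε₁ < ℓ₀`.
Let `F : X × ℝ → M` be a continuous family of loops on `[0, N]` (`F(x, 0) = F(x, N)`) in the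
interior `{ρ < 0}`, constant equal to `x₀` over `A ⊆ X`, and `1`-fine
(`d(F(x,s), F(x,t)) < ε₁` for `|s - t| ≤ 1`). Then there is a continuous deformation
`H : (X × ℝ) × [0, L] → M` through families of loops in `{ρ < 0}`, constant `x₀` over `A`, from
`F` (at `σ = 0`) to a family of CONSTANT loops (at `σ = L`). Construction (Birkhoff's
curve-shortening, as in the proof of the theorem of Lusternik–Fet; Milnor 1963, §16 for the
broken-geodesic approximation): sample `F(x, ·)` at the integers to get admissible geodesic
polygons `P x`; join `F` to the polygon loop of `P x`, then each `Ψ^j (P x)` to `Ψ^{j+1} (P x)`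
(`Ψ` the Birkhoff midpoint map), `m` times, where `m` is chosen by
`exists_forall_polygonEnergy_iterate_lt` (Dini; this is where non-trapping enters) so that
`Ψ^m (P x)` has energy `< η` for ALL `x`; finally join the polygon loop of `Ψ^m (P x)` to the
constant loop at its base vertex. Consecutive families are uniformly `3ε₁`-close, so each
junction is a short-geodesic homotopy inside `{ρ < 0}`.
[cite: PaternainSaloUhlmann2023, Prop. 3.7.22 and Remark 3.7.23] -/
theorem exists_deformation_to_const (hn : (∞ : ℕ∞ω) ≤ n) (hg : g.IsRiemannian) {X : Type*} [TopologicalSpace X]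
    (hρc : Continuous ρ) (hnt : IsNonTrappingSublevel g ρ)
    (hstay : ∀ γ : ℝ → M, IsGeodesic g.leviCivita γ →
      g.val (γ 0) (velocity I γ 0) (velocity I γ 0) < ℓ₀ ^ 2 →
      ρ (γ 0) ≤ 0 → ρ (γ 1) ≤ 0 → ∀ t ∈ Icc (0 : ℝ) 1, ρ (γ t) ≤ 0)
    (hstay' : ∀ γ : ℝ → M, IsGeodesic g.leviCivita γ →
      g.val (γ 0) (velocity I γ 0) (velocity I γ 0) < ℓ₀ ^ 2 →
      ρ (γ 0) < 0 → ρ (γ 1) < 0 → ∀ t ∈ Icc (0 : ℝ) 1, ρ (γ t) < 0)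
    (hε₁ : 0 < ε₁) (h3ε : 3 * ε₁ < uniformNormalRadius g hn hg) (h3ℓ : 3 * ε₁ < ℓ₀)
    {A : Set X} {x₀ : M} {F : X × ℝ → M} (hF : Continuous F)
    (hloop : ∀ x, F (x, 0) = F (x, N)) (hFD : ∀ x, ∀ t ∈ Icc (0 : ℝ) N, ρ (F (x, t)) < 0)
    (hFA : ∀ x ∈ A, ∀ t, F (x, t) = x₀)
    (hfine : ∀ (x : X) (s t : ℝ), s ∈ Icc (0 : ℝ) N → t ∈ Icc (0 : ℝ) N → |s - t| ≤ 1 →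
      g.edist hg (F (x, s)) (F (x, t)) < ENNReal.ofReal ε₁) :
    ∃ (L : ℕ) (_ : NeZero L) (Hh : X × ℝ → ℝ → M),
      ContinuousOn (fun p : (X × ℝ) × ℝ ↦ Hh p.1 p.2) (univ ×ˢ Icc 0 (L : ℝ)) ∧
      (∀ x, ∀ t ∈ Icc (0 : ℝ) N, Hh (x, t) 0 = F (x, t)) ∧
      (∀ x t t', Hh (x, t) L = Hh (x, t') L) ∧
      (∀ x σ, Hh (x, 0) σ = Hh (x, N) σ) ∧
      (∀ x ∈ A, ∀ t σ, Hh (x, t) σ = x₀) ∧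
      (∀ x t, ∀ σ ∈ Icc (0 : ℝ) L, ρ (Hh (x, t) σ) < 0) := by
  have hε := uniformNormalRadius_pos hn hg
  set ε := uniformNormalRadius g hn hg with hε_def
  have hε₁ε : ε₁ < ε := by linarith
  have hε₁ℓ : ε₁ < ℓ₀ := by linarith
  have hℓ₀ : 0 < ℓ₀ := by linarith
  set clamp : ℝ → ℝ := fun t ↦ max 0 (min t (N : ℝ)) with hclamp
  have hcl_mem : ∀ t, clamp t ∈ Icc (0 : ℝ) N := fun t ↦
    ⟨le_max_left _ _, max_le (Nat.cast_nonneg N) (min_le_right _ _)⟩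
  have hcl_c : Continuous clamp := continuous_const.max (continuous_id.min continuous_const)
  have hcl_id : ∀ t ∈ Icc (0 : ℝ) N, clamp t = t := fun t ht ↦ by
    show max 0 (min t (N : ℝ)) = t
    rw [min_eq_left ht.2, max_eq_right ht.1]
  have hcl0 : clamp 0 = 0 := hcl_id 0 ⟨le_rfl, Nat.cast_nonneg N⟩
  have hclN : clamp N = N := hcl_id N ⟨Nat.cast_nonneg N, le_rfl⟩
  -- the sampled polygons
  set P : X → Fin N → M := fun x i ↦ F (x, (i : ℕ)) with hP
  have hPc : Continuous P := continuous_pi fun i ↦ hF.comp (continuous_id.prodMk continuous_const)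
  have hIcc : ∀ i : Fin N, ((i : ℕ) : ℝ) ∈ Icc (0 : ℝ) N := fun i ↦
    ⟨Nat.cast_nonneg _, by exact_mod_cast i.2.le⟩
  have hPadm : ∀ x i, ρ (P x i) < 0 ∧ g.edist hg (P x i) (P x (i + 1)) ≤ ENNReal.ofReal ε₁ := by
    intro x i
    refine ⟨hFD x _ (hIcc i), ?_⟩
    show g.edist hg (F (x, ((i : ℕ) : ℝ))) (F (x, (((i + 1 : Fin N) : ℕ) : ℝ))) ≤ ENNReal.ofReal ε₁
    by_cases hlast : (i : ℕ) + 1 < N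
    · have hval : ((i + 1 : Fin N) : ℕ) = (i : ℕ) + 1 := by
        rw [Fin.val_add]; simp [Nat.mod_eq_of_lt hlast]
      rw [hval]
      refine (hfine x _ _ (hIcc i) ?_ ?_).le
      · exact ⟨by positivity, by exact_mod_cast hlast.le⟩
      · rw [Nat.cast_succ]; simp
    · have hiN : (i : ℕ) + 1 = N := by have := i.2; omega
      have hval : ((i + 1 : Fin N) : ℕ) = 0 := by
        rw [Fin.val_add]; simp [hiN]
      rw [hval, Nat.cast_zero, hloop x]
      refine (hfine x _ _ (hIcc i) ⟨Nat.cast_nonneg _, le_rfl⟩ ?_).le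
      have h1 : ((i : ℕ) : ℝ) + 1 = N := by exact_mod_cast hiN
      rw [abs_of_nonpos (by linarith)]
      linarith
  have hPadm' : ∀ x i, ρ (P x i) ≤ 0 ∧ g.edist hg (P x i) (P x (i + 1)) ≤ ENNReal.ofReal ε₁ :=
    fun x i ↦ ⟨(hPadm x i).1.le, (hPadm x i).2⟩
  -- the number of Birkhoff steps
  set η : ℝ := (ε₁ / ((N : ℝ) + 1)) ^ 2 with hη_def
  have hη : 0 < η := by positivity
  have hηδ : ((N : ℝ) + 1) * Real.sqrt η ≤ ε₁ := by
    rw [hη_def, Real.sqrt_sq (by positivity), mul_div_cancel₀ _ (by positivity : ((N : ℝ) + 1) ≠ 0)]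
  obtain ⟨m, hm⟩ := exists_forall_polygonEnergy_iterate_lt hn hg (N := N) hρc hnt hstay hε₁ℓ hε₁ε hε₁.le hη
  -- iterated polygons and their properties
  set Q : ℕ → X → Fin N → M := fun j x ↦ (birkhoffStep g hn hg)^[j] (P x) with hQ
  have hQadm : ∀ j x i, ρ (Q j x i) < 0 ∧ g.edist hg (Q j x i) (Q j x (i + 1)) ≤ ENNReal.ofReal ε₁ :=
    fun j x ↦ birkhoffStep_iterate_admissible_lt hn hg hstay hstay' hε₁ℓ hε₁ε hε₁.le j (hPadm x)
  have hQlt : ∀ j x i, g.edist hg (Q j x i) (Q j x (i + 1)) < ENNReal.ofReal ε := fun j x i ↦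
    lt_of_le_of_lt (hQadm j x i).2 ((ENNReal.ofReal_lt_ofReal_iff hε).2 hε₁ε)
  have hQc : ∀ j, Continuous (Q j) := by
    intro j
    have hK : ∀ x, P x ∈ {y : Fin N → M | ∀ i, ρ (y i) ≤ 0 ∧ g.edist hg (y i) (y (i + 1)) ≤ ENNReal.ofReal ε₁} :=
      fun x ↦ hPadm' x
    have hmaps : MapsTo (birkhoffStep g hn hg)
        {y : Fin N → M | ∀ i, ρ (y i) ≤ 0 ∧ g.edist hg (y i) (y (i + 1)) ≤ ENNReal.ofReal ε₁}
        {y : Fin N → M | ∀ i, ρ (y i) ≤ 0 ∧ g.edist hg (y i) (y (i + 1)) ≤ ENNReal.ofReal ε₁} :=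
      fun y hy ↦ birkhoffStep_admissible hn hg hstay hε₁ℓ hε₁ε hε₁.le hy
    have hcont : ContinuousOn ((birkhoffStep g hn hg)^[j])
        {y : Fin N → M | ∀ i, ρ (y i) ≤ 0 ∧ g.edist hg (y i) (y (i + 1)) ≤ ENNReal.ofReal ε₁} := by
      induction j with
      | zero => exact continuousOn_id
      | succ j ih =>
        rw [Function.iterate_succ']
        refine ((continuousOn_birkhoffStep hn hg).mono ?_).comp ih (hmaps.iterate j)
        exact fun y hy i ↦ lt_of_le_of_lt (hy i).2 ((ENNReal.ofReal_lt_ofReal_iff hε).2 hε₁ε)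
    exact hcont.comp_continuous hPc hK
  have hQA : ∀ j, ∀ x ∈ A, Q j x = fun _ ↦ x₀ := by
    intro j x hx
    have hPx : P x = fun _ ↦ x₀ := funext fun i ↦ hFA x hx _
    show (birkhoffStep g hn hg)^[j] (P x) = _
    rw [hPx, birkhoffStep_iterate_const]
  -- the families of loops: `fam 0 = F`, `fam (j+1) =` polygon of `Q j`, and the final constants
  set fam : ℕ → X × ℝ → M := fun j p ↦
    if j = 0 then F (p.1, clamp p.2)
    else if j ≤ m + 1 then polygonLoop g hn hg (Q (j - 1) p.1) (clamp p.2)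
    else Q m p.1 0 with hfam
  have hfam0 : ∀ p, fam 0 p = F (p.1, clamp p.2) := fun p ↦ by
    show (if (0 : ℕ) = 0 then F (p.1, clamp p.2)
      else if (0 : ℕ) ≤ m + 1 then polygonLoop g hn hg (Q (0 - 1) p.1) (clamp p.2) else Q m p.1 0) = _
    rw [if_pos rfl]
  have hfamS : ∀ j, j ≤ m → ∀ p, fam (j + 1) p = polygonLoop g hn hg (Q j p.1) (clamp p.2) := by
    intro j hj p
    show (if j + 1 = 0 then F (p.1, clamp p.2)
      else if j + 1 ≤ m + 1 then polygonLoop g hn hg (Q (j + 1 - 1) p.1) (clamp p.2) else Q m p.1 0) = _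
    rw [if_neg (Nat.succ_ne_zero j), if_pos (by omega), Nat.add_sub_cancel]
  have hfamL : ∀ j, m + 2 ≤ j → ∀ p, fam j p = Q m p.1 0 := by
    intro j hj p
    show (if j = 0 then F (p.1, clamp p.2)
      else if j ≤ m + 1 then polygonLoop g hn hg (Q (j - 1) p.1) (clamp p.2) else Q m p.1 0) = _
    rw [if_neg (by omega), if_neg (by omega)]
  -- (i) continuity
  have hfam_c : ∀ j, Continuous (fam j) := by
    intro j
    rcases Nat.eq_zero_or_pos j with rfl | hj
    · rw [show fam 0 = fun p ↦ F (p.1, clamp p.2) from funext hfam0]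
      exact hF.comp (continuous_fst.prodMk (hcl_c.comp continuous_snd))
    by_cases hjm : j ≤ m + 1
    · obtain ⟨j, rfl⟩ : ∃ j', j = j' + 1 := ⟨j - 1, by omega⟩
      have hj' : j ≤ m := by omega
      rw [show fam (j + 1) = fun p ↦ polygonLoop g hn hg (Q j p.1) (clamp p.2) from funext (hfamS j hj')]
      have h := continuousOn_polygonLoop hn hg (N := N)
      have h1 : Continuous fun p : X × ℝ ↦ (Q j p.1, clamp p.2) :=
        ((hQc j).comp continuous_fst).prodMk (hcl_c.comp continuous_snd)
      exact h.comp_continuous h1 fun p ↦ ⟨fun i ↦ hQlt j p.1 i, hcl_mem p.2⟩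
    · push Not at hjm
      rw [show fam j = fun p ↦ Q m p.1 0 from funext (hfamL j (by omega))]
      exact (continuous_apply 0).comp ((hQc m).comp continuous_fst)
  -- (ii) every family lies in the interior
  have h2ε₁ℓ : 2 * ε₁ ≤ ℓ₀ := by linarith
  have h2ε₁ε : 2 * ε₁ ≤ ε := by linarith
  have hpolyD : ∀ j x, ∀ t ∈ Icc (0 : ℝ) N, ρ (polygonLoop g hn hg (Q j x) t) < 0 := by
    intro j x t ht
    rw [show polygonLoop g hn hg (Q j x) t = geodesicSegment g hn hg (Q j x (pieceIndex N t))
      (Q j x (pieceIndex N t + 1)) (t - (pieceIndex N t : ℕ)) from rfl]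
    refine geodesicSegment_mem_lt hn hg hstay' h2ε₁ℓ h2ε₁ε (hQadm j x _).1 (hQadm j x _).1 ?_
      (sub_pieceIndex_mem_Icc ht)
    exact lt_of_le_of_lt (hQadm j x _).2 ((ENNReal.ofReal_lt_ofReal_iff (by positivity)).2 (by linarith))
  have hfamD : ∀ j p, ρ (fam j p) < 0 := by
    intro j p
    rcases Nat.eq_zero_or_pos j with rfl | hj
    · rw [hfam0]; exact hFD p.1 _ (hcl_mem p.2)
    by_cases hjm : j ≤ m + 1
    · obtain ⟨j, rfl⟩ : ∃ j', j = j' + 1 := ⟨j - 1, by omega⟩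
      rw [hfamS j (by omega)]
      exact hpolyD j p.1 _ (hcl_mem p.2)
    · push Not at hjm
      rw [hfamL j (by omega)]
      exact (hQadm m p.1 0).1
  -- (iii) consecutive families are `3ε₁`-close
  have hclose : ∀ j p, g.edist hg (fam j p) (fam (j + 1) p) < ENNReal.ofReal (3 * ε₁) := by
    intro j p
    obtain ⟨x, t⟩ := p
    have hct := hcl_mem t
    rcases Nat.eq_zero_or_pos j with rfl | hj
    · -- `F` versus the polygon of `P x`
      rw [hfam0, hfamS 0 (Nat.zero_le m)]
      show g.edist hg (F (x, clamp t)) (polygonLoop g hn hg (P x) (clamp t)) < _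
      set i := pieceIndex N (clamp t) with hi
      have hs := sub_pieceIndex_mem_Icc (N := N) hct
      have h1 : g.edist hg (F (x, clamp t)) (P x i) < ENNReal.ofReal ε₁ := by
        show g.edist hg (F (x, clamp t)) (F (x, ((i : ℕ) : ℝ))) < _
        refine hfine x _ _ hct (hIcc i) ?_
        rw [abs_of_nonneg hs.1]
        exact hs.2
      have h2 : g.edist hg (P x i) (polygonLoop g hn hg (P x) (clamp t)) ≤ ENNReal.ofReal ε₁ :=
        ((edist_polygonLoop_le hn hg (hQlt 0 x) hct).1).trans (hPadm x i).2
      calc g.edist hg (F (x, clamp t)) (polygonLoop g hn hg (P x) (clamp t))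
          ≤ g.edist hg (F (x, clamp t)) (P x i) + g.edist hg (P x i) (polygonLoop g hn hg (P x) (clamp t)) :=
            edist_triangle hg _ _ _
        _ < ENNReal.ofReal ε₁ + ENNReal.ofReal ε₁ :=
            ENNReal.add_lt_add_of_lt_of_le (ne_top_of_le_ne_top ENNReal.ofReal_ne_top h2) h1 h2
        _ = ENNReal.ofReal (2 * ε₁) := by rw [← ENNReal.ofReal_add hε₁.le hε₁.le]; ring_nf
        _ ≤ ENNReal.ofReal (3 * ε₁) := ENNReal.ofReal_le_ofReal (by linarith)
    by_cases hjm : j ≤ m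
    · -- polygon of `Q (j-1)` versus polygon of `Q j = Ψ (Q (j-1))`
      obtain ⟨j, rfl⟩ : ∃ j', j = j' + 1 := ⟨j - 1, by omega⟩
      rw [hfamS j (by omega), hfamS (j + 1) (by omega)]
      have hQsucc : Q (j + 1) x = birkhoffStep g hn hg (Q j x) := by
        show (birkhoffStep g hn hg)^[j + 1] (P x) = _
        rw [Function.iterate_succ_apply']
      rw [hQsucc]
      exact edist_polygonLoop_birkhoffStep_lt hn hg hε₁ε hε₁ (fun i ↦ (hQadm j x i).2)
        (fun i ↦ by rw [← hQsucc]; exact (hQadm (j + 1) x i).2) hct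
    · push Not at hjm
      by_cases hj1 : j = m + 1
      · -- polygon of `Q m` versus the constant loop
        subst hj1
        rw [hfamS m le_rfl, hfamL (m + 2) le_rfl]
        show g.edist hg (polygonLoop g hn hg (Q m x) (clamp t)) (Q m x 0) < _
        rw [PseudoRiemannianMetric.edist_comm hg]
        have hE : polygonEnergy g hg (Q m x) < η := hm (P x) (hPadm' x)
        exact lt_of_lt_of_le (edist_base_polygonLoop_lt_of_energy_lt hn hg (hQlt m x) hη hE hηδ hct)
          (ENNReal.ofReal_le_ofReal (by linarith))
      · -- both constant
        rw [hfamL j (by omega), hfamL (j + 1) (by omega), PseudoRiemannianMetric.edist_self hg]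
        exact ENNReal.ofReal_pos.2 (by positivity)
  -- the pieces of the deformation and the deformation
  set L : ℕ := m + 2 with hL
  haveI : NeZero L := ⟨by omega⟩
  set Pc : X × ℝ → Fin L → ℝ → M := fun p j σ ↦ geodesicSegment g hn hg (fam j p) (fam (j + 1) p) σ
    with hPc_def
  set Hh : X × ℝ → ℝ → M := fun p σ ↦ glueFin (Pc p) σ with hHh
  have hclose' : ∀ j p, g.edist hg (fam j p) (fam (j + 1) p) < ENNReal.ofReal ε := fun j p ↦
    lt_trans (hclose j p) ((ENNReal.ofReal_lt_ofReal_iff hε).2 h3ε)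
  refine ⟨L, inferInstance, Hh, ?_, ?_, ?_, ?_, ?_, ?_⟩
  · -- continuity
    refine continuousOn_glueFin (Q := Pc) (fun j ↦ ?_) (fun p i j hij ↦ ?_)
    · have h := continuous_geodesicSegment_family hn hg (hfam_c j) (hfam_c (j + 1)) (hclose' j)
      have h' : Continuous fun q : (X × ℝ) × ℝ ↦ Pc q.1 j q.2 :=
        h.comp (continuous_snd.prodMk continuous_fst)
      exact h'.continuousOn
    · show geodesicSegment g hn hg (fam i p) (fam (i + 1) p) 1 =
        geodesicSegment g hn hg (fam j p) (fam (j + 1) p) 0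
      rw [geodesicSegment_one hn hg (hclose' i p), geodesicSegment_zero, ← hij]
  · -- initial family
    intro x t ht
    show glueFin (Pc (x, t)) 0 = F (x, t)
    have h := glueFin_natCast (Pc (x, t)) (0 : Fin L)
    rw [Fin.val_zero, Nat.cast_zero] at h
    rw [h]
    show geodesicSegment g hn hg (fam 0 (x, t)) (fam (0 + 1) (x, t)) 0 = F (x, t)
    rw [geodesicSegment_zero, hfam0]
    show F (x, clamp t) = F (x, t)
    rw [hcl_id t ht]
  · -- final family is constant in `t`
    intro x t t'
    show glueFin (Pc (x, t)) (L : ℝ) = glueFin (Pc (x, t')) (L : ℝ)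
    rw [glueFin_last, glueFin_last]
    show geodesicSegment g hn hg (fam (L - 1) (x, t)) (fam (L - 1 + 1) (x, t)) 1 =
      geodesicSegment g hn hg (fam (L - 1) (x, t')) (fam (L - 1 + 1) (x, t')) 1
    rw [geodesicSegment_one hn hg (hclose' _ _), geodesicSegment_one hn hg (hclose' _ _),
      hfamL (L - 1 + 1) (by omega), hfamL (L - 1 + 1) (by omega)]
  · -- loops at every stage
    intro x σ
    show glueFin (Pc (x, 0)) σ = glueFin (Pc (x, N)) σ
    have hPc0 : Pc (x, 0) = Pc (x, N) := by
      funext j σ'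
      show geodesicSegment g hn hg (fam j (x, 0)) (fam (j + 1) (x, 0)) σ' =
        geodesicSegment g hn hg (fam j (x, N)) (fam (j + 1) (x, N)) σ'
      have hends : ∀ j, fam j (x, 0) = fam j (x, N) := by
        intro j
        rcases Nat.eq_zero_or_pos j with rfl | hj
        · rw [hfam0, hfam0]
          show F (x, clamp 0) = F (x, clamp N)
          rw [hcl0, hclN]
          exact hloop x
        by_cases hjm : j ≤ m + 1
        · obtain ⟨j, rfl⟩ : ∃ j', j = j' + 1 := ⟨j - 1, by omega⟩
          rw [hfamS j (by omega), hfamS j (by omega)]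
          show polygonLoop g hn hg (Q j x) (clamp 0) = polygonLoop g hn hg (Q j x) (clamp N)
          rw [hcl0, hclN, polygonLoop_zero, polygonLoop_last hn hg _ (hQlt j x _)]
        · push Not at hjm
          rw [hfamL j (by omega), hfamL j (by omega)]
      rw [hends j, hends (j + 1)]
    rw [hPc0]
  · -- constant over `A`
    intro x hx t σ
    have hfamA : ∀ j, fam j (x, t) = x₀ := by
      intro j
      rcases Nat.eq_zero_or_pos j with rfl | hj
      · rw [hfam0]; exact hFA x hx _
      by_cases hjm : j ≤ m + 1
      · obtain ⟨j, rfl⟩ : ∃ j', j = j' + 1 := ⟨j - 1, by omega⟩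
        rw [hfamS j (by omega)]
        show polygonLoop g hn hg (Q j x) (clamp t) = x₀
        rw [hQA j x hx, polygonLoop_const]
      · push Not at hjm
        rw [hfamL j (by omega)]
        show Q m x 0 = x₀
        rw [hQA m x hx]
    show glueFin (Pc (x, t)) σ = x₀
    rw [glueFin_eq]
    show geodesicSegment g hn hg (fam _ (x, t)) (fam _ (x, t)) _ = x₀
    rw [hfamA, hfamA, geodesicSegment_self]
  · -- in the interior
    intro x t σ hσ
    show ρ (glueFin (Pc (x, t)) σ) < 0
    rw [glueFin_eq]
    show ρ (geodesicSegment g hn hg (fam _ (x, t)) (fam _ (x, t)) _) < 0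
    exact geodesicSegment_mem_lt hn hg hstay' h3ℓ.le h3ε.le (hfamD _ _) (hfamD _ _) (hclose _ _)
      (sub_pieceIndex_mem_Icc hσ)

end Deformation

end Literature.Geometry.Riemannian
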